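/-
Copyright (c) 2026. All rights reserved.
Released under Apache 2.0 license as described in the file LICENSE.
-/
import Literature.NumberTheory.Weil1964.AdelicDoublingOriginValueInvariance
import HarnessLib

/-!
# The Siegel–Eisenstein section on the big Bruhat cell: `(ω(r_F(p · J · v(σ)))Φ)(0) = ∫ Φ(u) ψ_F(−½ ᵗu σ u) dν(u)`

Topic `NumberTheory/Weil1964`; namespace `Literature.NumberTheory.Weil1964`.  KERNEL MATHEMATICS ONLY (theorems over existing
tree declarations; no `def … : Prop`, no `axiom`, no proof hole).

THE PRINT.  [Weil1965, n° 39 (30) p. 55]: the Eisenstein–Siegel series is `E(Φ) = Σ_{γ ∈ P(k)\G(k)} (r(γ)Φ)(0)`; on the big cell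
`P(k) w N(k)` its terms are read off Weil's formulas for the standard representation [Weil1964, Chap. I n° 13 p. 160]: the
Weyl element `w` acts by the Fourier transform and `t(f)`, `f` a character of the second degree, by multiplication, so that
`(r(w t(f))Φ)(0) = (𝓕(f·Φ))(0) = ∫ Φ f` — the «fibre integrals» `∫ Φ(x) ψ(β q(x)) dx` of [Weil1965, n° 2 (3), n° 46–50] whose sum
over `β ∈ k` Poisson summation turns into Weil's measures `Σ_b μ_b(Φ)` ([Weil1965, n° 41 (34)–(35)]).

THE TREE'S SPELLING.  `F` a number field, `T ∈ GL_n(𝔸_F)` (`IsUnit T.det`), the Schrödinger model `𝒮(𝔸_Fⁿ) = piSchwartzBruhat F (Fin n)`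
of `Mp_ψ(W_𝔸)ᶜᵒⁿᵗ = adelicMpCont F (Fin n) T` with `ω = adelicMpCont.omega`, Weil's `Θ`-rigid rational section
`r_F = ratThetaLiftCont F T hT : Sp_{2n}(F) →* Mp_ψ(W_𝔸)ᶜᵒⁿᵗ` (★ `AdelicMetaplecticGenerators`) with its EXPLICIT VALUES on the
Siegel generators (★ `coe_ratThetaLiftCont_J`: `r_F(J) = (J_T, (fourierEquiv ν)⁻¹)` for any self-dual Haar measure `ν`,
`ν(Dⁿ) = 1`; ★ `coe_ratThetaLiftCont_low`: `r_F(v(σ)) = (v(T⁻¹σ), chirp(−½σ))`), the Siegel parabolic `P_Y = siegelParabolicPi T`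
of `Y = 0 × 𝔸ⁿ` (★ `AdelicSiegelParabolicLift`; `levi a`, `low σ ∈ P_Y`), and ★ `AdelicDoublingOriginValueInvariance`
(`(ω(r_F γ)Φ)(0) = Φ(0)` whenever `ratSp γ ∈ P_Y(𝔸)`).

WHAT IS HERE (all proved):
* §1 `omega_ratThetaLiftCont_J_apply_zero` — `(ω(r_F J)Φ)(0) = ∫ Φ dν` (`Φ̂(−0) = ∫ Φ`);
  `coe_omega_ratThetaLiftCont_low` — `ω(r_F(v(σ)))Φ = ψ_F(−½ ᵗu σ u)·Φ` pointwise (`chirp`);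
  **`omega_ratThetaLiftCont_bigCell_apply_zero`** — for `p` with `ratSp p ∈ P_Y(𝔸)` and `σ ∈ Sym_n(F)`:
  `(ω(r_F(p · J · v(σ)))Φ)(0) = ∫ u, ψ_F(−½ ᵗu σ u) Φ(u) ∂ν`.
* §2 the DOUBLING form used by the rank-one Siegel–Eisenstein series of the E-2 child line
  (`Cruxes/H413/Lines/F0_E2SiegelWeilWeilRange.lean`: `eisSection … Ψ q = (ω□(r_F δ) (ω□(r_F q.out⁻¹) Ψ))(0)`):
  **`omega_doublingDeltaLift_omega_ratThetaLiftCont_apply_zero_of_bigCell`** — if `δ x δ⁻¹ = p · J · v(σ)` with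
  `ratSp p ∈ P_𝕐(𝔸)` then `(ω□(r_F δ)(ω□(r_F x) Ψ))(0) = ∫ u, ψ_F(−½ ᵗu σ u) (ω□(r_F δ)Ψ)(u) ∂ν` — the big-cell term is the
  «fibre integral» `F*_{Ψ^δ}` of `Ψ^δ := ω□(r_F δ)Ψ` against the rational quadratic form `u ↦ −½ ᵗu σ u`.

Cell `hodgecm-mathlib`, P4 ∕ E-2, row (6) SW2-EIS-UNFOLD piece (B) (B-p02 (g18); F0P4-plan (g3) 01:40:57Z (1)); consumers: piece (C)
(the Bruhat representatives `r β` of `PW\IW` with `δ (r β)⁻¹ δ⁻¹ = p_β · J · v(β • C)`) and, through ★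
`Automorphic/SiegelEisensteinReindex`, the identity `eis Ψ = Ψ^δ(0) + Σ_{β ∈ F} F*_{Ψ^δ}(β)` («I-STRUCT-E», F0P2a-p08 (g4) census
2764d66b §4) with the letter `F*_Φ(β) = ∫ x, Φ x * ψ_F (β * h x) ∂ν` of F0P4-p06 (g2)'s Φ*-2.  HC_CM is proved only modulo the printed
citations until rung 0 closes — nothing here bears on it.

## References
* [Weil1965] A. Weil, *Sur la formule de Siegel dans la théorie des groupes classiques*, Acta Math. 113 (1965): n° 39 (30) p. 55,
  n° 41 (34)–(35) pp. 58–59, n° 46 p. 66.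
* [Weil1964] A. Weil, *Sur certains groupes d'opérateurs unitaires*, Acta Math. 111 (1964): Chap. I n° 13 p. 160 (`d₀`, `t₀`, and the
  Weyl element acting by `𝓕`), Chap. III n° 40–41 pp. 190–193 (`r_k`).
* [Kudla1996] S. S. Kudla, *Notes on the local theta correspondence* (1996), Chap. I §2 (the operators of `P_Y = MN` and of `w`).
-/

set_option autoImplicit false

noncomputable section

namespace Literature.NumberTheory.Weil1964

open Literature.RepresentationTheory.HeisenbergGroup Literature.RepresentationTheory.HeisenbergGroup.SymplecticMatrix
open Literature.NumberTheory.Automorphic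
open NumberField _root_.MeasureTheory
open scoped Matrix

/-! ## §1 The section on the Siegel generators and on the big cell -/

section Generic

variable (F : Type) [Field F] [NumberField F] {n : ℕ}
variable (T : Matrix (Fin n) (Fin n) (AdeleRing (𝓞 F) F)) (hT : IsUnit T.det)

/-- **`ω(r_F v(σ))` is the chirp `ψ_F(−½ ᵗu σ u)`** (★ `coe_ratThetaLiftCont_low`, ★ `coe_toOp_unipPair`), on underlying
functions. [cite: Weil1964, Chap. I n° 13 p. 160] -/
theorem coe_omega_ratThetaLiftCont_low (σ : Matrix (Fin n) (Fin n) F) (hσ : σ.IsSymm) (Φ : piSchwartzBruhat F (Fin n)) :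
    ((adelicMpCont.omega F (Fin n) T (ratThetaLiftCont F T hT (low σ hσ)) Φ : piSchwartzBruhat F (Fin n)) :
        (Fin n → AdeleRing (𝓞 F) F) → ℂ) =
      chirp F ((-⅟(2 : AdeleRing (𝓞 F) F)) • ratMatrix F σ) (Φ : (Fin n → AdeleRing (𝓞 F) F) → ℂ) := by
  have hc : ((adelicMpCont.omega F (Fin n) T (ratThetaLiftCont F T hT (low σ hσ)) Φ : piSchwartzBruhat F (Fin n)) :
        (Fin n → AdeleRing (𝓞 F) F) → ℂ) =
      ((MpPsi.toOp (adelicSchrodinger F (Fin n) T) (ratThetaLiftCont F T hT (low σ hσ) : adelicMp F (Fin n) T) Φ :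
        piSchwartzBruhat F (Fin n)) : (Fin n → AdeleRing (𝓞 F) F) → ℂ) := rfl
  rw [hc, coe_ratThetaLiftCont_low F T hT σ hσ]
  exact coe_toOp_unipPair F T hT (ratMatrix F σ) _ Φ

variable [MeasurableSpace (AdeleRing (𝓞 F) F)] [BorelSpace (AdeleRing (𝓞 F) F)]
  (ν : Measure (Fin n → AdeleRing (𝓞 F) F)) [ν.IsAddHaarMeasure]

/-- **`(ω(r_F J)Φ)(0) = ∫ Φ dν`**: the Weyl element acts by `Φ ↦ Φ̂(−·)` for the self-dual Haar measure `ν`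
(★ `coe_ratThetaLiftCont_J`, ★ `coe_fourierEquiv_symm`), and `Φ̂(0) = ∫ Φ`. [cite: Weil1964, Chap. I n° 13 p. 160] -/
theorem omega_ratThetaLiftCont_J_apply_zero (hν : ν (piFundamentalDomain F (Fin n)) = 1) (Φ : piSchwartzBruhat F (Fin n)) :
    ((adelicMpCont.omega F (Fin n) T (ratThetaLiftCont F T hT (SymplecticGroup.symJ (Fin n) F)) Φ :
        piSchwartzBruhat F (Fin n)) : (Fin n → AdeleRing (𝓞 F) F) → ℂ) 0 =
      ∫ v, (Φ : (Fin n → AdeleRing (𝓞 F) F) → ℂ) v ∂ν := by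
  have hc : ((adelicMpCont.omega F (Fin n) T (ratThetaLiftCont F T hT (SymplecticGroup.symJ (Fin n) F)) Φ :
        piSchwartzBruhat F (Fin n)) : (Fin n → AdeleRing (𝓞 F) F) → ℂ) =
      ((MpPsi.toOp (adelicSchrodinger F (Fin n) T)
          (ratThetaLiftCont F T hT (SymplecticGroup.symJ (Fin n) F) : adelicMp F (Fin n) T) Φ : piSchwartzBruhat F (Fin n)) :
        (Fin n → AdeleRing (𝓞 F) F) → ℂ) := rfl
  rw [hc, coe_ratThetaLiftCont_J F T hT ν hν, toOp_weylPair, coe_fourierEquiv_symm hν Φ]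
  simp [adelicPiFourier_apply]

/-- **THE SECTION ON THE BIG CELL.**  For `p ∈ Sp_{2n}(F)` with `ratSp p ∈ P_Y(𝔸)`, the Weyl element `J` and a rational symmetric
`σ`: `(ω(r_F(p · J · v(σ)))Φ)(0) = ∫ u, ψ_F(−½ ᵗu σ u) Φ(u) ∂ν` for the self-dual `ν` — `r_F` is a homomorphism, `P_Y` fixes
the origin value (★ `omega_ratThetaLiftCont_apply_zero_of_mem_siegelParabolicPi`), `J` integrates and `v(σ)` chirps.  This is
the term of the Eisenstein–Siegel series on the cell `P w N` («`(r(w t(f))Φ)(0) = ∫ Φ f`»).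
[cite: Weil1965, n° 39 (30) p. 55] [cite: Weil1964, Chap. I n° 13 p. 160] -/
theorem omega_ratThetaLiftCont_bigCell_apply_zero (hν : ν (piFundamentalDomain F (Fin n)) = 1)
    (p : Matrix.symplecticGroup (Fin n) F)
    (hp : ratSp F T hT p ∈ siegelParabolicPi T) (σ : Matrix (Fin n) (Fin n) F) (hσ : σ.IsSymm)
    (Φ : piSchwartzBruhat F (Fin n)) :
    ((adelicMpCont.omega F (Fin n) T (ratThetaLiftCont F T hT (p * SymplecticGroup.symJ (Fin n) F * low σ hσ)) Φ :
        piSchwartzBruhat F (Fin n)) : (Fin n → AdeleRing (𝓞 F) F) → ℂ) 0 =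
      ∫ v, chirp F ((-⅟(2 : AdeleRing (𝓞 F) F)) • ratMatrix F σ) (Φ : (Fin n → AdeleRing (𝓞 F) F) → ℂ) v ∂ν := by
  -- `ω(r_F(p J v)) Φ = ω(r_F p) (ω(r_F J) (ω(r_F v) Φ))`
  have e1 : adelicMpCont.omega F (Fin n) T (ratThetaLiftCont F T hT (p * SymplecticGroup.symJ (Fin n) F * low σ hσ)) Φ =
      adelicMpCont.omega F (Fin n) T (ratThetaLiftCont F T hT p)
        (adelicMpCont.omega F (Fin n) T (ratThetaLiftCont F T hT (SymplecticGroup.symJ (Fin n) F))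
          (adelicMpCont.omega F (Fin n) T (ratThetaLiftCont F T hT (low σ hσ)) Φ)) := by
    simp only [map_mul, Module.End.mul_apply]
  rw [e1, omega_ratThetaLiftCont_apply_zero_of_mem_siegelParabolicPi F T hT p hp,
    omega_ratThetaLiftCont_J_apply_zero F T hT ν hν, coe_omega_ratThetaLiftCont_low F T hT σ hσ Φ]

/-- The same with the chirp unfolded: `… = ∫ v, ψ_F((v ᵥ* (−½σ)) ⬝ᵥ v) · Φ v ∂ν`. [cite: Weil1965, n° 39 (30) p. 55]
[cite: Weil1964, Chap. I n° 13 p. 160] -/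
theorem omega_ratThetaLiftCont_bigCell_apply_zero' (hν : ν (piFundamentalDomain F (Fin n)) = 1)
    (p : Matrix.symplecticGroup (Fin n) F)
    (hp : ratSp F T hT p ∈ siegelParabolicPi T) (σ : Matrix (Fin n) (Fin n) F) (hσ : σ.IsSymm)
    (Φ : piSchwartzBruhat F (Fin n)) :
    ((adelicMpCont.omega F (Fin n) T (ratThetaLiftCont F T hT (p * SymplecticGroup.symJ (Fin n) F * low σ hσ)) Φ :
        piSchwartzBruhat F (Fin n)) : (Fin n → AdeleRing (𝓞 F) F) → ℂ) 0 =
      ∫ v, (adeleAddChar F ((v ᵥ* ((-⅟(2 : AdeleRing (𝓞 F) F)) • ratMatrix F σ)) ⬝ᵥ v) : ℂ) *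
        (Φ : (Fin n → AdeleRing (𝓞 F) F) → ℂ) v ∂ν := by
  rw [omega_ratThetaLiftCont_bigCell_apply_zero F T hT ν hν p hp σ hσ Φ]
  rfl

end Generic

/-! ## §2 The doubling form: the big-cell terms of the rank-one Siegel–Eisenstein series are fibre integrals of `Ψ^δ` -/

section Doubling

variable (F : Type) [Field F] [NumberField F] {n : ℕ}
variable (T : Matrix (Fin n) (Fin n) (AdeleRing (𝓞 F) F)) (hT : IsUnit T.det)
variable [MeasurableSpace (AdeleRing (𝓞 F) F)] [BorelSpace (AdeleRing (𝓞 F) F)]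
  (ν : Measure (Fin (n + n) → AdeleRing (𝓞 F) F)) [ν.IsAddHaarMeasure]

/-- **THE BIG-CELL TERM OF THE DOUBLED SIEGEL–EISENSTEIN SERIES IS A FIBRE INTEGRAL OF `Ψ^δ`.**  For rational doubled symplectic
matrices `x`, `p` and a rational symmetric `σ` with `δ x δ⁻¹ = p · J · v(σ)` (`δ = doublingDeltaRat`) and `ratSp p ∈ P_𝕐(𝔸)`:
`(ω□(r_F δ) (ω□(r_F x) Ψ))(0) = ∫ u, ψ_F(−½ ᵗu σ u) · (ω□(r_F δ)Ψ)(u) ∂ν` for the self-dual Haar measure `ν` of `𝔸_F^{n+n}` —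
since `r_F(δ) r_F(x) = r_F(δ x δ⁻¹) r_F(δ)` and §1 applies to `δ x δ⁻¹`.  With `x := (n(b) w)⁻¹` running over the big Bruhat cell of
the rank-one doubled unitary group this is the term `F*_{Ψ^δ}(β)` of «`E(Ψ) = Ψ^δ(0) + Σ_β F*_{Ψ^δ}(β)`».
[cite: Weil1965, n° 39 (30) p. 55] [cite: Weil1965, n° 46 p. 66] [cite: Weil1964, Chap. I n° 13 p. 160] -/
theorem omega_doublingDeltaLift_omega_ratThetaLiftCont_apply_zero_of_bigCell (hν : ν (piFundamentalDomain F (Fin (n + n))) = 1)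
    (x p : Matrix.symplecticGroup (Fin (n + n)) F)
    (σ : Matrix (Fin (n + n)) (Fin (n + n)) F) (hσ : σ.IsSymm)
    (hp : ratSp F (doubledGramFin F T) (isUnit_det_doubledGramFin F T hT) p ∈ siegelParabolicPi (doubledGramFin F T))
    (hx : doublingDeltaRat F * x * (doublingDeltaRat F)⁻¹ = p * SymplecticGroup.symJ (Fin (n + n)) F * low σ hσ)
    (Ψ : piSchwartzBruhat F (Fin (n + n))) :
    ((adelicMpCont.omega F (Fin (n + n)) (doubledGramFin F T) (doublingDeltaLift F T hT)
          (adelicMpCont.omega F (Fin (n + n)) (doubledGramFin F T)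
            (ratThetaLiftCont F (doubledGramFin F T) (isUnit_det_doubledGramFin F T hT) x) Ψ) :
          piSchwartzBruhat F (Fin (n + n))) : (Fin (n + n) → AdeleRing (𝓞 F) F) → ℂ) 0 =
      ∫ v, chirp F ((-⅟(2 : AdeleRing (𝓞 F) F)) • ratMatrix F σ)
        ((adelicMpCont.omega F (Fin (n + n)) (doubledGramFin F T) (doublingDeltaLift F T hT) Ψ :
            piSchwartzBruhat F (Fin (n + n))) : (Fin (n + n) → AdeleRing (𝓞 F) F) → ℂ) v ∂ν := by
  unfold doublingDeltaLift
  -- in the metaplectic group: `r_F(δ) r_F(x) = r_F(δxδ⁻¹) r_F(δ) = r_F(p J v(σ)) r_F(δ)`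
  have e1 : ratThetaLiftCont F (doubledGramFin F T) (isUnit_det_doubledGramFin F T hT) (doublingDeltaRat F) *
        ratThetaLiftCont F (doubledGramFin F T) (isUnit_det_doubledGramFin F T hT) x =
      ratThetaLiftCont F (doubledGramFin F T) (isUnit_det_doubledGramFin F T hT)
          (p * SymplecticGroup.symJ (Fin (n + n)) F * low σ hσ) *
        ratThetaLiftCont F (doubledGramFin F T) (isUnit_det_doubledGramFin F T hT) (doublingDeltaRat F) := by
    have e0 : ratThetaLiftCont F (doubledGramFin F T) (isUnit_det_doubledGramFin F T hT) (doublingDeltaRat F) *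
          ratThetaLiftCont F (doubledGramFin F T) (isUnit_det_doubledGramFin F T hT) x =
        ratThetaLiftCont F (doubledGramFin F T) (isUnit_det_doubledGramFin F T hT)
            (doublingDeltaRat F * x * (doublingDeltaRat F)⁻¹) *
          ratThetaLiftCont F (doubledGramFin F T) (isUnit_det_doubledGramFin F T hT) (doublingDeltaRat F) := by
      simp only [map_mul, map_inv, inv_mul_cancel_right]
    exact e0.trans (congrArg (fun y => ratThetaLiftCont F (doubledGramFin F T) (isUnit_det_doubledGramFin F T hT) y *
      ratThetaLiftCont F (doubledGramFin F T) (isUnit_det_doubledGramFin F T hT) (doublingDeltaRat F)) hx)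
  -- on vectors
  have e2 : ∀ Ψ' : piSchwartzBruhat F (Fin (n + n)),
      adelicMpCont.omega F (Fin (n + n)) (doubledGramFin F T)
          (ratThetaLiftCont F (doubledGramFin F T) (isUnit_det_doubledGramFin F T hT) (doublingDeltaRat F))
          (adelicMpCont.omega F (Fin (n + n)) (doubledGramFin F T)
            (ratThetaLiftCont F (doubledGramFin F T) (isUnit_det_doubledGramFin F T hT) x) Ψ') =
        adelicMpCont.omega F (Fin (n + n)) (doubledGramFin F T)
          (ratThetaLiftCont F (doubledGramFin F T) (isUnit_det_doubledGramFin F T hT)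
            (p * SymplecticGroup.symJ (Fin (n + n)) F * low σ hσ))
          (adelicMpCont.omega F (Fin (n + n)) (doubledGramFin F T)
            (ratThetaLiftCont F (doubledGramFin F T) (isUnit_det_doubledGramFin F T hT) (doublingDeltaRat F)) Ψ') :=
    fun Ψ' =>
    ((LinearMap.congr_fun (map_mul (adelicMpCont.omega F (Fin (n + n)) (doubledGramFin F T)) _ _) Ψ').symm.trans
      ((congrArg (fun m => adelicMpCont.omega F (Fin (n + n)) (doubledGramFin F T) m Ψ') e1).trans
        (LinearMap.congr_fun (map_mul (adelicMpCont.omega F (Fin (n + n)) (doubledGramFin F T)) _ _) Ψ')))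
  exact (congrArg (fun Φ' : piSchwartzBruhat F (Fin (n + n)) => (Φ' : (Fin (n + n) → AdeleRing (𝓞 F) F) → ℂ) 0)
      (e2 Ψ)).trans
    (omega_ratThetaLiftCont_bigCell_apply_zero F (doubledGramFin F T) (isUnit_det_doubledGramFin F T hT) ν hν p hp σ hσ
      (adelicMpCont.omega F (Fin (n + n)) (doubledGramFin F T)
        (ratThetaLiftCont F (doubledGramFin F T) (isUnit_det_doubledGramFin F T hT) (doublingDeltaRat F)) Ψ))

end Doubling

end Literature.NumberTheory.Weil1964

end
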